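import Literature.NumberTheory.NumberFields.RayClassFieldTwoVariableTowerData
import Literature.NumberTheory.NumberFields.RayClassFieldFrobeniusOrderFull
import HarnessLib

/-!
# THE LOCAL TOWER DATA OF THE (c)-CAPSTONE WITH A 2-POWER OFFSET: `(α) = 𝔭_v^f`, `f = d₀·p^r` the FULL residue degree of `v` in `K(𝔤₀)`
# (`d₀` prime to `p`), unramified tower `E_j` of degree `d₀·p^j`, offset `c = r + 1` — the binders `hdegE / hinert₀ / hcount` HOLD

`RayClassFieldTwoVariableTowerData` (g16 S40) discharges the local tower binders of the (c)-capstone from ONE `α` under `f ∣ d`, `d` prime to `p`,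
`d ∣ ord Frob_v(K(𝔤₀))` — which forces `f = d = ord Frob_v(K(𝔤₀))` to be ODD at `p = 2` (fine for `K = ℚ(√−7)`, `𝔤₀ = 𝔣 = (√−7)`, `f = 3`; NOT for
a conductor `𝔤₀ ⊇ 𝔣_θ` of a quadratic character `θ`, where the residue degree of `v` in `K(𝔤₀)` is typically even).  With the FULL Frobenius-order
growth `f·p^{n−m+1} ∣ ord Frob_v(K(𝔤₀v'^n))` (`RayClassFieldFrobeniusOrderFull`, `f` of any parity) the same construction works with the `p`-part of
`f` absorbed into the OFFSET: `f = d₀·p^r`, `E_j` of degree `d₀·p^j`, `c := r + 1` (the completion of `K(𝔤v'^{i+1})`, `𝔤 = 𝔤₀v'^a`, contains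
`E_{i+r+1}`).  THIS file proves, with `α_i := α^{p^{i+1}}`, `f_i := f·p^{i+1}` (the `α`-data `towerData_hα0/hα𝔪/hαw/hαπ` and `hw_of_towerData` of
S40 are unchanged):

* ★ `towerDataOffset_hdegE` — `f·p^{i+1} = [E_{i+r+1}:K_v] ∣ deg w` on `Γ_{E_{i+r+1}}`;
* ★★ **`towerDataOffset_hinert`** — INERT from level `0` with offset `r + 1`: `[E_{i+r+1}:K_v] = d₀·p^{i+r+1} ∣ ord Frob_v(K(𝔤₀v'^{a+i+1}))`;
* ★ `towerDataOffset_hcount` — `[K(𝔤v'^{i+2}v^{k+1}) : K(𝔤v'^{i+1}v^{k+1})]·[E_{i+r+1}] ≤ [E_{i+r+2}]`.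

So the (c)-identity on the trace (`…ColemanCoinvariantCharTraceEllipticUnits…_liftable_eq_span`) is instantiable for EVERY modulus `𝔤₀` prime to
`2` with `w_{𝔤₀} = 1` over any `K` with `2 = v·v̄` split, given one `α ≡ 1 mod 𝔤₀` generating `𝔭_v^f`, `f` = the order of `[𝔭_v]` in `Cl_{𝔤₀}(K)`.
Cell `bsd-print-cf2`, width seat `bsd-line-cf2c-w7` g17.  Theorems only; no `sorry`; no definitions.

## References
* [deShalit1987] E. de Shalit, *Iwasawa theory of elliptic curves with complex multiplication* (1987), II.1.9 (p. 43), II.1.10 (p. 39),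
  II.4.14 (p. 71), II.4.17 (p. 78).
* [Serre1973CourseArithmetic] J.-P. Serre, *A Course in Arithmetic* (1973), Ch. II §3.1.
* [NeukirchANT1999] J. Neukirch, *Algebraic Number Theory* (1999), Ch. VI §7 Thm. (7.1), Cor. (7.3); Ch. IV §4.
-/

noncomputable section

open NumberField IsDedekindDomain IsDedekindDomain.HeightOneSpectrum Field WithZero
open scoped nonZeroDivisors Classical

namespace Literature.NumberTheory.NumberFields

open Literature.NumberTheory.GaloisRepresentations
open Literature.NumberTheory.GaloisRepresentations.IsNonarchimedeanLocalField
open Literature.NumberTheory.GaloisRepresentations.ArtinLocalGlobal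
open Literature.RingTheory.DedekindDomain
open ValuativeRel

variable {K : Type} [Field K] [NumberField K] {𝔤₀ : Ideal (𝓞 K)} {v v' : HeightOneSpectrum (𝓞 K)}

/-! ### §0. Moduli bookkeeping -/

omit [NumberField K] in
/-- `𝔤₀v'^a·v'^{i+1} = 𝔤₀·v'^{a+(i+1)}`. [folklore] -/
private theorem moduli_eq₂₂ (a i : ℕ) : 𝔤₀ * v'.asIdeal ^ a * v'.asIdeal ^ (i + 1) = 𝔤₀ * v'.asIdeal ^ (a + (i + 1)) := by
  rw [mul_assoc, ← pow_add]

omit [NumberField K] in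
/-- `𝔤₀v'^a·v'^{i+1}·v^{k+1} = (𝔤₀v^{k+1})·v'^{(a+i)+1}`. [folklore] -/
private theorem moduli₂_eq₂₂ (a i k : ℕ) :
    𝔤₀ * v'.asIdeal ^ a * v'.asIdeal ^ (i + 1) * v.asIdeal ^ (k + 1) = 𝔤₀ * v.asIdeal ^ (k + 1) * v'.asIdeal ^ (a + i + 1) := by
  rw [show a + i + 1 = a + (i + 1) by ring, pow_add]; ring

/-- `v ∤ 𝔤₀v'^n` for `v ∤ 𝔤₀`, `v ≠ v'`. [cite: deShalit1987, II.4.14 (p. 71)] -/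
private theorem not_mul_pow_le₂₂ (hv : ¬ 𝔤₀ ≤ v.asIdeal) (hvv' : v' ≠ v) (n : ℕ) : ¬ 𝔤₀ * v'.asIdeal ^ n ≤ v.asIdeal := by
  intro h
  rcases (v.isPrime.mul_le).mp h with h1 | h2
  · exact hv h1
  · rcases n with _ | n
    · rw [pow_zero, Ideal.one_eq_top, top_le_iff] at h2
      exact v.isPrime.ne_top h2
    · exact hvv' (HeightOneSpectrum.ext ((v'.isMaximal.eq_of_le v.isPrime.ne_top ((Ideal.IsPrime.pow_le_iff (hP := v.isPrime)
        (Nat.succ_ne_zero n)).mp h2))))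

/-- A prime not containing `𝔪` is coprime to it. [folklore] -/
private theorem isCoprime_of_not_le₂₂ {𝔪 : Ideal (𝓞 K)} (h : ¬ 𝔪 ≤ v'.asIdeal) : IsCoprime 𝔪 v'.asIdeal := by
  rw [Ideal.isCoprime_iff_sup_eq]
  exact v'.isMaximal.out.2 _ (lt_of_le_of_ne le_sup_right fun e ↦ h (e ▸ le_sup_left))

variable [IsTotallyComplex K]
  (h𝔤0 : 𝔤₀ ≠ ⊥) (hv : ¬ 𝔤₀ ≤ v.asIdeal) (hv' : ¬ 𝔤₀ ≤ v'.asIdeal) (hvv' : v' ≠ v)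
  (hw𝔤 : ∀ u : (𝓞 K)ˣ, (u : 𝓞 K) - 1 ∈ 𝔤₀ → u = 1)
  {p : ℕ} (hp : p.Prime) (hdeg1 : Nat.card (𝓞 K ⧸ v'.asIdeal) = p) (hpv' : (p : 𝓞 K) ∈ v'.asIdeal) (hpv'2 : (p : 𝓞 K) ∉ v'.asIdeal ^ 2)
  {π : 𝒪[v.adicCompletion K]} (hπ : (valuation (v.adicCompletion K)).IsUniformizer (π : v.adicCompletion K))
  {α : 𝓞 K} (hα0 : α ≠ 0) (hα𝔤 : α - 1 ∈ 𝔤₀)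
  {f : ℕ} (hαf : Ideal.span {α} = v.asIdeal ^ f)
  {ℓ a : ℕ} (hℓ : 1 ≤ ℓ) (hαℓ : v'.intValuation (α - 1) = exp (-(ℓ : ℤ)))
  (ha2 : 2 ≤ a + 1 ∨ p ≠ 2) (hαa : v'.intValuation (α ^ p - 1) = exp (-((a + 1 : ℕ) : ℤ)))
  -- the residue degree `f = d₀·p^r` of `v` in `K(𝔤₀)`, 2-power part included
  {d₀ r : ℕ} (hf : f = d₀ * p ^ r) (hfo : f ∣ orderOf (galFrob K (rayClassField K 𝔤₀) v))
  (E : ℕ → IntermediateField (v.adicCompletion K) (AlgebraicClosure (v.adicCompletion K)))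
  [∀ j, FiniteDimensional (v.adicCompletion K) (E j)]
  (hE : ∀ j, E j ≤ maxUnramified (v.adicCompletion K)) (hEdeg : ∀ j, Module.finrank (v.adicCompletion K) (E j) = d₀ * p ^ j)

/-! ### `hdegE`, `hinert₀`, `hcount` for the unramified tower `E_j` of degree `d₀·p^j`, offset `c = r + 1` -/

omit [IsTotallyComplex K] in
include hf hE hEdeg in
/-- ★ **`hdegE` with offset `r + 1`**: a Weil element fixing `E_{i+r+1}` has `f·p^{i+1} = [E_{i+r+1}:K_v] ∣ deg w`.
[cite: NeukirchANT1999, Ch. IV §4] [cite: deShalit1987, II.1.10 (p. 39)] -/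
theorem towerDataOffset_hdegE [CharZero (v.adicCompletion K)] : ∀ i : ℕ, ∀ w : WeilGroup (v.adicCompletion K),
    WeilGroup.toAbsGalois (v.adicCompletion K) w ∈ (E (i + (r + 1))).fixingSubgroup → ((f * p ^ (i + 1) : ℕ) : ℤ) ∣ WeilGroup.deg w := by
  intro i w hw
  have hmem : w ∈ LocalWeilDatum.fieldSubgroup (v.adicCompletion K) (E (i + (r + 1))) := by
    rw [LocalWeilDatum.mem_fieldSubgroup_iff]
    intro x hx
    rw [Field.absoluteGaloisGroup.smul_def]
    exact (IntermediateField.mem_fixingSubgroup_iff _ _).mp hw x hx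
  have hdeg := (mem_fieldSubgroup_iff_dvd_deg_of_le_maxUnramified (hE (i + (r + 1))) w).mp hmem
  rw [hEdeg (i + (r + 1))] at hdeg
  have e : f * p ^ (i + 1) = d₀ * p ^ (i + (r + 1)) := by rw [hf]; ring
  rwa [e]

include h𝔤0 hv hv' hvv' hw𝔤 hp hpv' hpv'2 hπ hα0 hα𝔤 hαf hℓ hαℓ ha2 hαa hf hfo hE hEdeg in
/-- ★★ **`hinert₀` with offset `r + 1`** (INERT from level `0`): every `τ ∈ Γ_{K_v}` fixing `ι K(𝔤v'^{i+1})` pointwise (`𝔤 = 𝔤₀v'^a`) fixes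
`E_{i+r+1}`, because `[E_{i+r+1}:K_v] = d₀·p^{i+r+1} = f·p^{i+1}` divides `ord Frob_v(K(𝔤₀v'^{a+i+1}))` (FULL growth from `α`, the `p`-part `p^r` of
the residue degree kept). [cite: deShalit1987, II.1.10 (p. 39), II.4.14 (p. 71)] [cite: NeukirchANT1999, Ch. VI §7 Cor. (7.3)] -/
theorem towerDataOffset_hinert : ∀ i : ℕ, ∀ τ : absoluteGaloisGroup (v.adicCompletion K),
    (∀ y ∈ rayClassField K (𝔤₀ * v'.asIdeal ^ a * v'.asIdeal ^ (i + 1)),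
      τ • absClosureEmbedding K (v.adicCompletion K) y = absClosureEmbedding K (v.adicCompletion K) y) →
      τ ∈ (E (i + (r + 1))).fixingSubgroup := by
  intro i τ hτ
  rw [moduli_eq₂₂] at hτ
  refine mem_fixingSubgroup_of_forall_smul_absClosureEmbedding_eq_of_finrank_dvd_orderOf (mul_ne_zero h𝔤0 (pow_ne_zero _ v'.ne_bot))
    (not_mul_pow_le₂₂ hv hvv' _) hπ (E (i + (r + 1))) (hE (i + (r + 1))) ?_ hτ
  have h := mul_pow_prime_succ_dvd_orderOf_frob_idelic_of_dvd_orderOf h𝔤0 hv hv' hvv' hw𝔤 hp hpv' hpv'2 hα0 hα𝔤 hαf hℓ hαℓ ha2 hαa hfo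
    (n := a + (i + 1)) (by omega) hπ
  rw [show a + (i + 1) - (a + 1) + 1 = i + 1 by omega] at h
  have e : f * p ^ (i + 1) = d₀ * p ^ (i + (r + 1)) := by rw [hf]; ring
  rwa [hEdeg (i + (r + 1)), ← e]

omit [∀ j, FiniteDimensional (v.adicCompletion K) (E j)] in
include h𝔤0 hv' hvv' hw𝔤 hp hdeg1 hpv' hpv'2 hEdeg in
/-- ★ **`hcount` with offset `r + 1`**: `[K(𝔤v'^{i+2}v^{k+1}) : K(𝔤v'^{i+1}v^{k+1})]·[E_{i+r+1}:K_v] ≤ [E_{i+r+2}:K_v]` (layer degree `p`,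
`[E_{j+1}] = p·[E_j]`). [cite: deShalit1987, II.1.9 (p. 43), II.4.14 (p. 71)] -/
theorem towerDataOffset_hcount : ∀ i k : ℕ,
    IntermediateField.relfinrank (rayClassField K (𝔤₀ * v'.asIdeal ^ a * v'.asIdeal ^ (i + 1) * v.asIdeal ^ (k + 1)))
        (rayClassField K (𝔤₀ * v'.asIdeal ^ a * v'.asIdeal ^ (i + 1 + 1) * v.asIdeal ^ (k + 1))) *
      Module.finrank (v.adicCompletion K) (E (i + (r + 1))) ≤ Module.finrank (v.adicCompletion K) (E (i + 1 + (r + 1))) := by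
  intro i k
  haveI := Fact.mk hp
  have h𝔣 : 𝔤₀ * v.asIdeal ^ (k + 1) ≠ ⊥ := mul_ne_zero h𝔤0 (pow_ne_zero _ v.ne_bot)
  have hcop : IsCoprime (𝔤₀ * v.asIdeal ^ (k + 1)) v'.asIdeal :=
    (isCoprime_of_not_le₂₂ hv').mul_left (isCoprime_of_not_le₂₂ (fun h ↦ hvv' (HeightOneSpectrum.ext
      ((v.isMaximal.eq_of_le v'.isPrime.ne_top ((Ideal.IsPrime.pow_le_iff (hP := v'.isPrime) (Nat.succ_ne_zero k)).mp h)).symm))))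
  have hw' : ∀ u : (𝓞 K)ˣ, (u : 𝓞 K) - 1 ∈ 𝔤₀ * v.asIdeal ^ (k + 1) * v'.asIdeal → u = 1 :=
    fun u hu ↦ hw𝔤 u (Ideal.mul_le_right (Ideal.mul_le_right hu))
  have hrel := relfinrank_rayClassField_mul_pow_succ_succ v' hdeg1 (intValuation_natCast_eq_of_mem_of_not_mem_sq v' hpv' hpv'2) h𝔣 hcop
    hw' (a + i)
  rw [moduli₂_eq₂₂, moduli₂_eq₂₂, show a + (i + 1) + 1 = a + i + 2 by ring, hrel, hEdeg, hEdeg, show i + 1 + (r + 1) = (i + (r + 1)) + 1 by ring,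
    pow_succ]
  exact le_of_eq (by ring)

end Literature.NumberTheory.NumberFields

end
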